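import Literature.Barriers.CriticalPhenomena.LongRangeDiscontinuityProofs
import Literature.Probability.Percolation.LongRangeRenormalization
import Literature.Probability.Percolation.ProdBernoulliZeroOne
import Mathlib.Analysis.SpecialFunctions.Pow.Asymptotics
import HarnessLib

/-!
# Discharge of the barrier `LongRangeDiscontinuity` (Aizenman–Newman 1986, Prop. 1.1)

Barrier catalogue `Literature/Barriers/CriticalPhenomena/`, second proofs-only sibling of
`LongRangeDiscontinuity.lean` (the first, `LongRangeDiscontinuityProofs.lean`, assembles
`AizenmanNewman1986_family` from its two inputs and reduces the family dichotomy
`DuminilCopinGarbanTassion2024_dichotomy` to the barrier): here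
`theorem LongRangeDiscontinuity_holds : LongRangeDiscontinuity` — in an independent,
translation-invariant, regular bond model on `ℤ` with `β = limsup K_n n²`, a positive
percolation density `M` forces `β M² ≥ 1` — whence the discharges
`DuminilCopinGarbanTassion2024_dichotomy_holds` and the now one-input assembly
`AizenmanNewman1986_family_of_transition : NewmanSchulman1986_transition →
AizenmanNewman1986_family`.

The vendored statement is Aizenman–Newman's Prop. 1.1 (whose printed proof, §§2–4 of the
paper, is a 30-page renormalisation of "anchored bonds"); the proof formalised here is the
short renormalisation of Duminil-Copin, Garban and Tassion, *Long-range models in 1D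
revisited*, Ann. Inst. H. Poincaré Probab. Statist. 60 (2024), arXiv:2011.04642, Thm. 1(ii)
and §2.4 (Lemma 3), stated there for `p_{ij} = 1 - exp(-β/|i-j|²)` and carried out here for
general `K` with `limsup K_n n² = β` and `K_n < 1` (the only uses of the specific family in the
printed proof are `p_{ij} ≤ β'/|i-j|²` for large `|i-j|`, `p̄(C₀) > 0`, and translation
invariance). The deterministic part is `Probability/Percolation/LongRangeOneDim.lean`,
`LongRangeBridges.lean`, `LongRangeEscape.lean`; the probabilistic part
`LongRangeModel.lean` … `LongRangeRenormalization.lean`; the zero–one law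
`ProdBernoulliZeroOne.lean`.

## Contents

* `longRangePercolation_eq_lrMeasure`, `percolationDensity_eq` — identification of the model of
  the barrier file with `lrMeasure K`;
* `exists_eps_of_mul_sq_lt_one`, `exists_firstScale`, `exists_dilation` — the choice of the
  parameters `ε` (`θ₁ = M + ε`, `β' = β + ε`, `β' θ₁² < 1`), of `δ`, the exponent `s' < 1`,
  the first scale `K₀` and the dilation factor `C`;
* `tendsto_real_box_percolates` — `P(some x ∈ [-3K_n, 3K_n] percolates) → 1` when `M > 0`
  (zero–one law and continuity from below);
* `LongRangeDiscontinuity_holds`, `DuminilCopinGarbanTassion2024_dichotomy_holds`,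
  `AizenmanNewman1986_family_of_transition`.

## References

* M. Aizenman, C. M. Newman, *Discontinuity of the percolation density in one-dimensional
  `1/|x-y|²` percolation models*, Comm. Math. Phys. 107 (1986) 611–647: §1, Prop. 1.1.
* H. Duminil-Copin, C. Garban, V. Tassion, *Long-range models in 1D revisited*, Ann. Inst.
  H. Poincaré Probab. Statist. 60 (2024), arXiv:2011.04642: §2.4 (Thm. 1(ii), Lemma 3).
-/

noncomputable section

namespace Literature.Barriers.CriticalPhenomena

open MeasureTheory Filter Literature.Probability.Percolation Literature.Probability.LatticeModels
open scoped ENNReal Topology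

/-! ### Identification of the model -/

/-- The long-range model of the barrier file is `lrMeasure K = prodBernoulli (edgeProb K)` of
`LongRangeModel.lean` (same edge probabilities, written with `edgeLen`). [folklore] -/
theorem longRangePercolation_eq_lrMeasure (K : ℕ → unitInterval) :
    longRangePercolation K = lrMeasure K := by
  unfold longRangePercolation lrMeasure
  congr 1
  funext e
  induction e using Sym2.ind with
  | h x y => rfl

/-- `M = P(|C(0)| = ∞)` computed in `lrMeasure K`. [folklore] -/
theorem percolationDensity_eq (K : ℕ → unitInterval) :
    percolationDensity K = (lrMeasure K).real (percolatesAt (0 : ℤ)) := by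
  rw [percolationDensity, longRangePercolation_eq_lrMeasure]

/-! ### Choice of the parameters -/

/-- Room above `β M² < 1`: some `ε ∈ (0, 1]` keeps `(β + ε)(M + ε)² < 1`. [folklore] -/
theorem exists_eps_of_mul_sq_lt_one {b m : ℝ} (hb : 0 ≤ b) (hm : 0 ≤ m) (h : b * m ^ 2 < 1) :
    ∃ ε : ℝ, 0 < ε ∧ ε ≤ 1 ∧ (b + ε) * (m + ε) ^ 2 < 1 := by
  set A := b * (2 * m + 1) + (m + 1) ^ 2 + 1 with hA
  have hApos : 0 < A := by positivity
  refine ⟨min 1 ((1 - b * m ^ 2) / (2 * A)), lt_min one_pos (div_pos (by linarith) (by positivity)),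
    min_le_left _ _, ?_⟩
  set ε := min 1 ((1 - b * m ^ 2) / (2 * A)) with hε
  have hε0 : 0 < ε := lt_min one_pos (div_pos (by linarith) (by positivity))
  have hε1 : ε ≤ 1 := min_le_left _ _
  have hεA : ε * A ≤ (1 - b * m ^ 2) / 2 := by
    have : ε ≤ (1 - b * m ^ 2) / (2 * A) := min_le_right _ _
    rw [le_div_iff₀ (by positivity)] at this
    linarith
  have h1 : (m + ε) ^ 2 ≤ m ^ 2 + ε * (2 * m + 1) := by nlinarith
  have h2 : (m + ε) ^ 2 ≤ (m + 1) ^ 2 := by nlinarith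
  calc (b + ε) * (m + ε) ^ 2 = b * (m + ε) ^ 2 + ε * (m + ε) ^ 2 := by ring
    _ ≤ b * (m ^ 2 + ε * (2 * m + 1)) + ε * (m + 1) ^ 2 := by gcongr
    _ = b * m ^ 2 + ε * (b * (2 * m + 1) + (m + 1) ^ 2) := by ring
    _ ≤ b * m ^ 2 + ε * A := by gcongr; linarith
    _ < 1 := by linarith

/-- **Choice of `δ`, of the target exponent `s' < 1` and of the first scale `K₀`** from
`β' θ₁² < 1`: all side conditions of the renormalisation step hold at `K₀` (and, by
monotonicity, beyond). [folklore] -/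
theorem exists_firstScale {β' θ₁ : ℝ} (hβ : 0 < β') (hg : β' * θ₁ ^ 2 < 1) (R D : ℕ) :
    ∃ δ s' : ℝ, 0 < δ ∧ s' < 1 ∧ ∃ k₀ : ℕ, 1 ≤ k₀ ∧ R ≤ k₀ ∧ D < k₀ ∧
      2 * β' ≤ ((k₀ : ℝ) + 1) ^ 2 ∧
      bridgeTheta β' θ₁ k₀ R * (β' / (k₀ : ℝ) ^ 2) ≤ δ / (1 + δ) ∧
      (1 + δ) * (β' * bridgeTheta β' θ₁ k₀ R) ≤ s' := by
  set g1 := β' * θ₁ ^ 2 with hg1def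
  have hg0 : 0 ≤ g1 := by positivity
  set δ := (1 - g1) / (4 * (g1 + 1)) with hδ
  have hδpos : 0 < δ := div_pos (by linarith) (by positivity)
  set η₀ := (1 - g1) / (4 * (β' * (1 + δ))) with hη₀
  have hη₀pos : 0 < η₀ := div_pos (by linarith) (by positivity)
  set N : ℝ := (((2 * R + 1) * (2 * R + 1) : ℕ) : ℝ) with hN
  have hN0 : 0 ≤ N := by positivity
  set Q := 2 * β' + N * β' / η₀ + (θ₁ ^ 2 + η₀) * β' * (1 + δ) / δ with hQ
  have hQ1 : 2 * β' ≤ Q := by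
    have : 0 ≤ N * β' / η₀ := by positivity
    have : 0 ≤ (θ₁ ^ 2 + η₀) * β' * (1 + δ) / δ := by positivity
    linarith
  have hQ2 : N * β' / η₀ ≤ Q := by
    have : 0 ≤ (θ₁ ^ 2 + η₀) * β' * (1 + δ) / δ := by positivity
    linarith
  have hQ3 : (θ₁ ^ 2 + η₀) * β' * (1 + δ) / δ ≤ Q := by
    have : 0 ≤ N * β' / η₀ := by positivity
    linarith
  set k₀ : ℕ := ⌈Q⌉₊ + R + D + 1 with hk₀
  have hk₀Q : Q ≤ k₀ := by
    rw [hk₀]; push_cast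
    linarith [Nat.le_ceil Q, (Nat.cast_nonneg R : (0 : ℝ) ≤ R), (Nat.cast_nonneg D : (0 : ℝ) ≤ D)]
  have hk₀1 : 1 ≤ k₀ := by omega
  have hk₀pos : (0 : ℝ) < k₀ := by exact_mod_cast hk₀1
  have hk₀ge1 : (1 : ℝ) ≤ k₀ := by exact_mod_cast hk₀1
  have hdivk : ∀ {x : ℝ}, 0 ≤ x → x / (k₀ : ℝ) ^ 2 ≤ x / k₀ := fun hx =>
    div_le_div_of_nonneg_left hx hk₀pos (by nlinarith)
  refine ⟨δ, (1 + g1) / 2, hδpos, by linarith, k₀, hk₀1, by omega, by omega, ?_, ?_, ?_⟩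
  · nlinarith
  · -- smallness: `θ₂² ≤ θ₁² + η₀` and `(θ₁² + η₀) β'/k₀ ≤ δ/(1+δ)`
    have hηk : N * (β' / (k₀ : ℝ) ^ 2) ≤ η₀ := by
      have h2 : N * β' / η₀ ≤ k₀ := le_trans hQ2 hk₀Q
      rw [div_le_iff₀ hη₀pos] at h2
      rw [mul_div_assoc']
      refine le_trans (hdivk (by positivity)) ?_
      rw [div_le_iff₀ hk₀pos]
      linarith
    have hθ₂le : bridgeTheta β' θ₁ k₀ R ≤ θ₁ ^ 2 + η₀ := by
      unfold bridgeTheta; rw [← hN]; linarith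
    have h1 : (θ₁ ^ 2 + η₀) * β' * (1 + δ) / δ ≤ k₀ := le_trans hQ3 hk₀Q
    rw [div_le_iff₀ hδpos] at h1
    calc bridgeTheta β' θ₁ k₀ R * (β' / (k₀ : ℝ) ^ 2)
        ≤ (θ₁ ^ 2 + η₀) * (β' / k₀) :=
          mul_le_mul hθ₂le (hdivk hβ.le) (by positivity) (by positivity)
      _ ≤ δ / (1 + δ) := by
          rw [mul_div_assoc', div_le_div_iff₀ hk₀pos (by positivity)]
          nlinarith
  · have hηk : N * (β' / (k₀ : ℝ) ^ 2) ≤ η₀ := by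
      have h2 : N * β' / η₀ ≤ k₀ := le_trans hQ2 hk₀Q
      rw [div_le_iff₀ hη₀pos] at h2
      rw [mul_div_assoc']
      refine le_trans (hdivk (by positivity)) ?_
      rw [div_le_iff₀ hk₀pos]
      linarith
    have hθ₂le : bridgeTheta β' θ₁ k₀ R ≤ θ₁ ^ 2 + η₀ := by
      unfold bridgeTheta; rw [← hN]; linarith
    have h1 : (1 + δ) * (β' * bridgeTheta β' θ₁ k₀ R) ≤ (1 + δ) * (β' * (θ₁ ^ 2 + η₀)) := by
      gcongr
    have h2 : (1 + δ) * (β' * (θ₁ ^ 2 + η₀)) = g1 + δ * g1 + (1 + δ) * β' * η₀ := by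
      rw [hg1def]; ring
    have h3 : δ * g1 ≤ (1 - g1) / 4 := by
      rw [hδ, div_mul_eq_mul_div, div_le_div_iff₀ (by positivity) (by positivity)]
      nlinarith
    have h4 : (1 + δ) * β' * η₀ = (1 - g1) / 4 := by
      rw [hη₀]; field_simp
    linarith

/-- **Choice of the dilation factor `C`**: `C ≥ 17`, `C ≥ 1/q` and `C^{1-s'} ≥ 18 e^{152β'+s'}`,
the last written as the product used in the renormalisation step. [folklore] -/
theorem exists_dilation (β' : ℝ) {s' : ℝ} (q : ℝ) (hs' : s' < 1) :
    ∃ C : ℕ, 17 ≤ C ∧ 1 / q ≤ (C : ℝ) ∧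
      18 ≤ (C : ℝ) * (Real.exp (-(152 * β')) * (Real.exp (-s') *
        Real.exp (-(s' * Real.log C)))) := by
  have hevC : ∀ᶠ C : ℕ in atTop, 17 ≤ C ∧ 1 / q ≤ (C : ℝ) ∧
      18 * Real.exp (152 * β' + s') ≤ (C : ℝ) ^ (1 - s') := by
    refine (eventually_ge_atTop 17).and ((tendsto_natCast_atTop_atTop.eventually_ge_atTop
      (1 / q)).and ?_)
    exact ((tendsto_rpow_atTop (by linarith : 0 < 1 - s')).comp
      tendsto_natCast_atTop_atTop).eventually_ge_atTop _
  obtain ⟨C, hC17, hCq, hCbig⟩ := hevC.exists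
  refine ⟨C, hC17, hCq, ?_⟩
  have hCpos : (0 : ℝ) < C := by exact_mod_cast lt_of_lt_of_le (by norm_num) hC17
  have h1 : (C : ℝ) * Real.exp (-(s' * Real.log C)) = (C : ℝ) ^ (1 - s') := by
    rw [show -(s' * Real.log C) = Real.log C * (-s') by ring, ← Real.rpow_def_of_pos hCpos,
      show (1 : ℝ) - s' = 1 + -s' by ring, Real.rpow_add hCpos, Real.rpow_one]
  have h2 : Real.exp (152 * β' + s') * (Real.exp (-(152 * β')) * Real.exp (-s')) = 1 := by
    rw [← Real.exp_add, ← Real.exp_add, show 152 * β' + s' + (-(152 * β') + -s') = 0 by ring,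
      Real.exp_zero]
  calc (18 : ℝ) = 18 * Real.exp (152 * β' + s') * (Real.exp (-(152 * β')) * Real.exp (-s')) := by
        rw [mul_assoc, h2, mul_one]
    _ ≤ (C : ℝ) ^ (1 - s') * (Real.exp (-(152 * β')) * Real.exp (-s')) :=
        mul_le_mul_of_nonneg_right hCbig (by positivity)
    _ = (C : ℝ) * (Real.exp (-(152 * β')) * (Real.exp (-s') *
        Real.exp (-(s' * Real.log C)))) := by rw [← h1]; ring

/-! ### The probability that a growing box meets an infinite cluster -/

/-- If `M > 0` then, by the zero–one law, almost surely some vertex percolates; hence the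
probability that some `x ∈ [-3K_n, 3K_n]` percolates tends to `1` along any non-decreasing
sequence of scales with `K_n ≥ n`.
[cite: DuminilcopinGarbanTassion2024, §2.4 (proof of Thm. 1(ii), "by measurability")] -/
theorem tendsto_real_box_percolates {K : ℕ → unitInterval}
    (hM : 0 < (lrMeasure K).real (percolatesAt (0 : ℤ))) {κ : ℕ → ℕ} (hmono : Monotone κ)
    (hge : ∀ n : ℕ, n ≤ κ n) :
    Tendsto (fun n => (lrMeasure K).real
      {ω : BondConfig ℤ | ∃ x : ℤ, (-(3 * (κ n : ℤ)) ≤ x ∧ x ≤ 3 * (κ n : ℤ)) ∧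
        ω ∈ percolatesAt x}) atTop (𝓝 1) := by
  have hone : (lrMeasure K).real {ω : BondConfig ℤ | ∃ x : ℤ, ω ∈ percolatesAt x} = 1 :=
    prodBernoulli_real_exists_percolatesAt_eq_one (edgeProb K) (x := (0 : ℤ)) hM
  set An : ℕ → Set (BondConfig ℤ) := fun n =>
    {ω | ∃ x : ℤ, (-(3 * (κ n : ℤ)) ≤ x ∧ x ≤ 3 * (κ n : ℤ)) ∧ ω ∈ percolatesAt x} with hAn
  have hAmono : Monotone An := by
    intro n m hnm ω ⟨x, hx, hω⟩
    have : (κ n : ℤ) ≤ κ m := by exact_mod_cast hmono hnm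
    exact ⟨x, by omega, hω⟩
  have hUnion : (⋃ n, An n) = {ω : BondConfig ℤ | ∃ x : ℤ, ω ∈ percolatesAt x} := by
    ext ω
    simp only [Set.mem_iUnion, Set.mem_setOf_eq, hAn]
    constructor
    · rintro ⟨n, x, -, hω⟩; exact ⟨x, hω⟩
    · rintro ⟨x, hω⟩
      refine ⟨x.natAbs, x, ?_, hω⟩
      have : (x.natAbs : ℤ) ≤ κ x.natAbs := by exact_mod_cast hge x.natAbs
      omega
  have h := tendsto_measure_iUnion_atTop (μ := lrMeasure K) hAmono
  rw [hUnion] at h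
  have h' := (ENNReal.tendsto_toReal (measure_ne_top (lrMeasure K) _)).comp h
  rwa [← measureReal_def, hone] at h'

/-! ### The Aizenman–Newman dichotomy -/

/-- **Discharge of the barrier `LongRangeDiscontinuity` (Aizenman–Newman 1986, Prop. 1.1):** in an
independent, translation-invariant, regular long-range bond model on `ℤ`, `M > 0` forces
`β M² ≥ 1`. Proof following Duminil-Copin–Garban–Tassion (AIHP 2024, Thm. 1(ii), §2.4), made
quantitative for general `K` with `limsup K_n n² = β`: if `β M² < 1`, pick `θ₁ > M`, `β' > β`
with `β' θ₁² < 1`, a radius `R` with `P(0 exits its R-ball) ≤ θ₁`, a decay threshold with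
`K_n ≤ β'/n²`, a first scale `K₀` and a dilation factor `C`; the renormalisation
(`inv_le_real_compl_cross_pow`) gives `P(block of scale Cⁿ K₀ not crossed) ≥ 1/C` at all scales,
whence `P(A(Cⁿ K₀)) ≤ 1 - e^{-152β'}/C²` (`real_escape_le`); but `A(Cⁿ K₀)` contains "some
`x ∈ [-3CⁿK₀, 3CⁿK₀]` percolates", whose probability tends to `P(∃ x, |C(x)| = ∞) = 1` (zero–one
law) — a contradiction.
[cite: AizenmanNewman1986, Prop. 1.1] [cite: DuminilcopinGarbanTassion2024, Thm. 1(ii) and §2.4] -/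
theorem LongRangeDiscontinuity_holds : LongRangeDiscontinuity := by
  intro K hreg hMpos
  by_contra hlt
  push Not at hlt
  have hM1 : percolationDensity K ≤ 1 := (percolationDensity_mem_Icc K).2
  -- `β < ∞` and the real inequality `β M² < 1`
  have hM2 : ENNReal.ofReal (percolationDensity K) ^ 2 ≠ 0 := by
    refine pow_ne_zero _ fun h => ?_
    rw [ENNReal.ofReal_eq_zero] at h
    linarith
  have hβtop : betaAN K ≠ ∞ := by
    intro h
    rw [h, ENNReal.top_mul hM2] at hlt
    exact absurd hlt (not_lt.2 le_top)
  have hβr0 : 0 ≤ (betaAN K).toReal := ENNReal.toReal_nonneg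
  have hβeq : betaAN K = ENNReal.ofReal (betaAN K).toReal := (ENNReal.ofReal_toReal hβtop).symm
  have hg : (betaAN K).toReal * percolationDensity K ^ 2 < 1 := by
    rw [hβeq, ← ENNReal.ofReal_pow hMpos.le, ← ENNReal.ofReal_mul hβr0, ← ENNReal.ofReal_one,
      ENNReal.ofReal_lt_ofReal_iff one_pos] at hlt
    exact hlt
  -- Step 1: `θ₁ = M + ε`, `β' = β + ε`
  obtain ⟨ε, hε0, -, hg1⟩ := exists_eps_of_mul_sq_lt_one hβr0 hMpos.le hg
  set β' := (betaAN K).toReal + ε with hβ'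
  set θ₁ := percolationDensity K + ε with hθ₁
  have hβ'pos : 0 < β' := by positivity
  -- Step 2: decay threshold and radius
  have hlim : limsup (fun n : ℕ => ENNReal.ofReal (K n) * (n : ℝ≥0∞) ^ 2) atTop <
      ENNReal.ofReal β' := by
    show betaAN K < _
    rw [hβeq]
    exact (ENNReal.ofReal_lt_ofReal_iff hβ'pos).2 (by linarith)
  obtain ⟨D, hD⟩ := exists_decay_of_limsup_lt K hβ'pos hlim
  have hMθ : (lrMeasure K).real (percolatesAt (0 : ℤ)) < θ₁ := by
    rw [← percolationDensity_eq]; linarith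
  obtain ⟨R, hRθ⟩ := exists_real_exits_le K hMθ
  -- Step 3: `δ`, `s'`, `k₀`
  obtain ⟨δ, s', hδpos, hs'1, k₀, hk₀1, hk₀R, hk₀D, hk2, hsmall, hs'⟩ :=
    exists_firstScale hβ'pos hg1 R D
  have hdecay : ∀ n : ℕ, k₀ < n → (K n : ℝ) ≤ β' / (n : ℝ) ^ 2 :=
    fun n hn => hD n (by omega)
  -- Step 4: the dilation factor `C`
  have hqpos : 0 < regConst K k₀ ^ (k₀ * k₀) := pow_pos (regConst_pos hreg k₀) _
  obtain ⟨C, hC17, hCq, hbig⟩ := exists_dilation β' (regConst K k₀ ^ (k₀ * k₀)) hs'1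
  have hCpos : (0 : ℝ) < C := by exact_mod_cast lt_of_lt_of_le (by norm_num) hC17
  have hbase : ∀ c : ℤ, (1 / C : ℝ) ≤ (lrMeasure K).real (cross k₀ c)ᶜ := by
    intro c
    refine le_trans ?_ (regConst_pow_le_real_compl_cross (K := K) hk₀1 c)
    rw [div_le_iff₀ hCpos]
    rw [div_le_iff₀ hqpos] at hCq
    linarith
  -- Step 5: all scales `Cⁿ k₀`, and the escape bound
  have hscale : ∀ n : ℕ, ∀ c : ℤ, (1 / C : ℝ) ≤ (lrMeasure K).real (cross (C ^ n * k₀) c)ᶜ :=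
    inv_le_real_compl_cross_pow (K := K) hβ'pos hδpos hk₀1 hC17 hk₀R hdecay hk2 hRθ hsmall hs'
      hbig hbase
  have hC1 : 1 ≤ C := le_trans (by norm_num) hC17
  have hKn : ∀ n : ℕ, k₀ ≤ C ^ n * k₀ := fun n => Nat.le_mul_of_pos_left k₀ (pow_pos (by omega) n)
  have hescape : ∀ n : ℕ, (lrMeasure K).real (escape (C ^ n * k₀)) ≤
      1 - Real.exp (-(152 * β')) * (1 / C) ^ 2 := by
    intro n
    refine real_escape_le (K := K) hβ'pos (le_trans hk₀1 (hKn n))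
      (fun m hm => hdecay m (lt_of_le_of_lt (hKn n) hm)) ?_ (by positivity) (hscale n)
    have : (k₀ : ℝ) ≤ (C ^ n * k₀ : ℕ) := by exact_mod_cast hKn n
    nlinarith
  -- Step 6: the box `[-3Cⁿk₀, 3Cⁿk₀]` meets an infinite cluster with probability `→ 1`
  have hMpos' : 0 < (lrMeasure K).real (percolatesAt (0 : ℤ)) := by
    rwa [← percolationDensity_eq]
  have hκmono : Monotone fun n : ℕ => C ^ n * k₀ := fun n m hnm =>
    Nat.mul_le_mul_right k₀ (Nat.pow_le_pow_right hC1 hnm)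
  have hκge : ∀ n : ℕ, n ≤ C ^ n * k₀ := fun n =>
    le_trans (le_trans (Nat.lt_pow_self (by norm_num : 1 < 2)).le
      (Nat.pow_le_pow_left (le_trans (by norm_num) hC17) n)) (Nat.le_mul_of_pos_right _ hk₀1)
  have hlimA := tendsto_real_box_percolates hMpos' hκmono hκge
  -- Step 7: contradiction
  have hη : 0 < Real.exp (-(152 * β')) * (1 / (C : ℝ)) ^ 2 := by positivity
  obtain ⟨n, hn⟩ := Filter.eventually_atTop.1 (hlimA.eventually_const_lt
    (show 1 - Real.exp (-(152 * β')) * (1 / (C : ℝ)) ^ 2 < 1 by linarith))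
  have h1 := hn n le_rfl
  have h2 : (lrMeasure K).real {ω : BondConfig ℤ | ∃ x : ℤ,
      (-(3 * ((C ^ n * k₀ : ℕ) : ℤ)) ≤ x ∧ x ≤ 3 * ((C ^ n * k₀ : ℕ) : ℤ)) ∧ ω ∈ percolatesAt x} ≤
      (lrMeasure K).real (escape (C ^ n * k₀)) :=
    measureReal_mono fun ω ⟨x, hx, hω⟩ => percolatesAt_subset_escape hx hω
  linarith [hescape n]

/-! ### Consequences for the `1/|x-y|²` family -/

/-- **Discharge of `DuminilCopinGarbanTassion2024_dichotomy`** (Duminil-Copin–Garban–Tassion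
2024, Thm. 1(ii): "For every `β, λ > 0`, `θ(β, λ) > 0` implies `β θ(β, λ)² ≥ 1`"), by
specialising Prop. 1.1 to the family (1.7) (`LongRangeDiscontinuity.dichotomy_anFamily`).
[cite: DuminilcopinGarbanTassion2024, Thm. 1(ii)] -/
theorem DuminilCopinGarbanTassion2024_dichotomy_holds : DuminilCopinGarbanTassion2024_dichotomy :=
  LongRangeDiscontinuity_holds.dichotomy_anFamily

/-- **The phase diagram of the `1/|x-y|²` family from Newman–Schulman's transition alone**
(Aizenman–Newman 1986, p. 615 (a)–(b)): with Prop. 1.1 proved, the assembly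
`AizenmanNewman1986_family_of` needs only the existence of a transition.
[cite: AizenmanNewman1986, §1 (iii) pp. 614–615 ((1.7), (a)–(b))] -/
theorem AizenmanNewman1986_family_of_transition (hNS : NewmanSchulman1986_transition) :
    AizenmanNewman1986_family :=
  AizenmanNewman1986_family_of hNS LongRangeDiscontinuity_holds

end Literature.Barriers.CriticalPhenomena
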